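import Literature.Computability.QuantumComplexity.IQPPostselection
import HarnessLib

/-!
# From post-BQP to post-IQP: the structure of BJS Theorem 1

Family `quantum-advantage`; refines the named fact `PP_subset_PostIQPWith` of
`IQPPostselection.lean` (Bremner–Jozsa–Shepherd 2011, Thm. 1, arXiv:1005.1407 p. 7, in the
inclusion form consumed by Thm. 2 / Cor. 1) into the three steps of the printed proof:

1. `PP = PostBQP` — Aaronson's theorem (Aaronson 2005, Thm. 2), the tree's named fact
   `Literature.Computability.Cryptography.PostBQP_eq_PP`;
2. post-BQP does not depend on the error tolerance (BJS §2.4): `PostBQP ⊆ PostBQPWith ε` for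
   every `0 < ε < 1/2` — named fact `PostBQP_subset_PostBQPWith`;
3. the **Hadamard gadget** (BJS proof of Thm. 1, Fig. 1): every uniform post-selected
   Clifford+T family is converted into a uniform post-selected IQP family with the *same*
   conditional acceptance probabilities, so `PostBQPWith ε ⊆ PostIQPWith ε` for every `ε` —
   named fact `PostBQPWith_subset_PostIQPWith`;

and proves the assembly `PP_subset_PostIQPWith_of`. `PostBQPWith ε` is the tree's `PostBQP`
(Q4 `Postselection`: Clifford+T, output wire `0`, post-selection wire `1`) with the thresholds
`2/3, 1/3` replaced by `1-ε, ε` (`PostBQPWith_one_third : PostBQPWith (1/3) = PostBQP`).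
-/

open Computability Literature.Computability.Complexity Literature.Computability.Cryptography

namespace Literature.Computability.QuantumComplexity

/-- **`PostBQPWith ε`**: post-BQP at error tolerance `ε` — the tree's `PostBQP` (poly-time uniform,
oracle-free Clifford+T family; on every input the post-selection wire reads `1` with positive
probability, and conditioned on this the output wire reads `1` with probability `≥ 1-ε` if
`x ∈ L`, `≤ ε` if `x ∉ L`). (BJS 2011, Def. 3 (post-BQP with tolerance `ε`); Aaronson 2005,
Def. 1.) [cite: BremnerJozsaShepherdPRSA2011, Def. 3] -/
def PostBQPWith (ε : ℝ) : Set (Language Bool) :=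
  {L | ∃ F : QCircuitFamily cliffordT, F.IsOracleFree ∧ F.IsUniform ∧
    ∀ x, 0 < F.postselectProbOn 0 x ∧
      (x ∈ L → 1 - ε ≤ F.condAcceptProbOn 0 x) ∧ (x ∉ L → F.condAcceptProbOn 0 x ≤ ε)}

/-- At tolerance `1/3` this is literally the tree's `PostBQP`. (Aaronson 2005, Def. 1.) [cite: Aaronson2005, Def. 1] -/
theorem PostBQPWith_one_third : PostBQPWith (1 / 3) = PostBQP := by
  simp only [PostBQPWith, PostBQP]
  norm_num

/-- Tightening the tolerance below `1/3` only strengthens the thresholds: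
`PostBQPWith ε ⊆ PostBQP` for `ε ≤ 1/3` (the easy half of tolerance-independence). [folklore] -/
theorem PostBQPWith_subset_PostBQP_of_le {ε : ℝ} (hε : ε ≤ 1 / 3) : PostBQPWith ε ⊆ PostBQP := by
  rintro L ⟨F, hF, hU, h⟩
  refine ⟨F, hF, hU, fun x => ?_⟩
  obtain ⟨hpos, hyes, hno⟩ := h x
  exact ⟨hpos, fun hx => le_trans (by linarith) (hyes hx), fun hx => le_trans (hno hx) (by linarith)⟩

/-- **Post-BQP error reduction**: `PostBQP ⊆ PostBQPWith ε` for every `0 < ε < 1/2` (run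
polynomially many copies in parallel on fresh ancillas, post-select on all post-selection wires —
an AND computed reversibly into wire `1` — and write the majority of the output wires into wire
`0`; Chernoff). (BJS 2011, §2.4: "post-BPP and post-BQP are easily seen to be independent of the
error tolerance value"; Aaronson 2005, §2.) [cite: BremnerJozsaShepherdPRSA2011, §2.4] -/
def PostBQP_subset_PostBQPWith : Prop :=
  ∀ ε : ℝ, 0 < ε → ε < 1 / 2 → PostBQP ⊆ PostBQPWith ε

/-- **The Hadamard gadget reduction** (BJS 2011, proof of Thm. 1 with Fig. 1): every language
decided with tolerance `ε` by a uniform post-selected Clifford+T family (input `|x⟩|0…0⟩`, output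
wire `0`, post-selection wire `1`) is decided with the same tolerance by a uniform post-selected
IQP family in the register normal form of `PostIQPFamily`. Construction: write `S = T²`,
`CNOT_{ct} = H_t CZ_{ct} H_t`; insert `H·H = I` so that every line begins and ends with `H`; replace
each intermediate `H_a` by a fresh line `e` (initialised `|0⟩`, beginning and ending with `H`) and
a `CZ_{ae}`, post-selecting outcome `0` on line `a`, which leaves `H|ψ⟩` on line `e` ("an easy
calculation"); the SWAPs relabelling `e` as `a` are commuted to the end of the lines, i.e. become a
relabelling of output positions. The resulting circuit is `H^{⊗N} D H^{⊗N}` on `|x⟩|0…0⟩` with `D`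
over `{Z, CZ, T}` and has the same output conditional probabilities, now also conditioned on the
new post-selections (each of probability `1/2`, so positivity is preserved); the first gadget on
each input line post-selects the physical input wire, the original post-selection wire (value `1`)
is flipped by a `Z` before its final `H`, and ancilla wires are permuted so that the output sits on
wire `n` and the post-selected ancillas on `n+1, …`. Uniformity is preserved because the rewriting
is computable in polynomial time from the circuit description. [cite: BremnerJozsaShepherdPRSA2011, Thm. 1 (proof, Hadamard gadget)] -/
def PostBQPWith_subset_PostIQPWith : Prop :=
  ∀ ε : ℝ, PostBQPWith ε ⊆ PostIQPWith ε

/-- **BJS Theorem 1 (inclusion form) from its printed steps**: for `0 < ε < 1/2`,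
`PP = PostBQP ⊆ PostBQPWith ε ⊆ PostIQPWith ε` (Aaronson's theorem; post-BQP error reduction;
Hadamard gadget). (BJS 2011, proof of Thm. 1 with §2.4.) [cite: BremnerJozsaShepherdPRSA2011, Thm. 1 (proof)] -/
theorem PP_subset_PostIQPWith_of (hA : Literature.Computability.Cryptography.PostBQP_eq_PP)
    (hamp : PostBQP_subset_PostBQPWith) (hgadget : PostBQPWith_subset_PostIQPWith) :
    PP_subset_PostIQPWith := by
  intro ε hε0 hε1 L hL
  have hL' : L ∈ PostBQP := by
    have h : PostBQP = PP := hA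
    rw [h]; exact hL
  exact hgadget ε (hamp ε hε0 hε1 hL')

/-- Hence the corrected S22 from: Aaronson's theorem, post-BQP error reduction, the Hadamard
gadget, the simulation argument, `PostBPP ⊆ PP`, Toda, HHT 1997, Stockmeyer, `P^{P^O} = P^O`.
(BJS 2011, Thm. 1, Thm. 2, Cor. 1.) [cite: BremnerJozsaShepherdPRSA2011, Cor. 1 (proof)] -/
theorem PH_eq_DeltaP_three_of_uniform_iqp_multiplicative_of_gadget_facts
    (hA : Literature.Computability.Cryptography.PostBQP_eq_PP) (hamp : PostBQP_subset_PostBQPWith)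
    (hgadget : PostBQPWith_subset_PostIQPWith) (hSim : mem_PostBPP_of_samplesMultiplicative)
    (hPostBPP : PostBPP_subset_PP) (hToda : toda_PH_subset_PRelClass_PP)
    (hHHT : PostBPP_subset_DeltaP_three) (hΔ : DeltaP_succ_subset_SigmaP_inter_PiP)
    (hcomp : mem_PRel_of_polyTimeTuringReducible) :
    PH_eq_DeltaP_three_of_uniform_iqp_multiplicative :=
  PH_eq_DeltaP_three_of_uniform_iqp_multiplicative_of_atomic_facts
    (PP_subset_PostIQPWith_of hA hamp hgadget) hSim hPostBPP hToda hHHT hΔ hcomp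

end Literature.Computability.QuantumComplexity
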